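import Mathlib
import HarnessLib
import Literature.Analysis.FluidPDE.SuitableWeak
import Literature.Analysis.FluidPDE.SelfSimilar
import Literature.Analysis.FluidPDE.LocalTypeI
import Literature.Analysis.FluidPDE.SpaceTimeRescaling
import Literature.Analysis.FluidPDE.LocalTypeIScaling
import Literature.Analysis.FluidPDE.LocalTypeICongr
import Literature.Analysis.FluidPDE.LocalTypeIReverseZoom
import Literature.Analysis.FluidPDE.SlabTypeICompactness
import Literature.Analysis.FluidPDE.TypeIRateOseenMildRepresentative
import Summits.NavierStokesRegularity.NavierStokesRegularity.Theorems.RellichScarApexLocalisationSpherePersistence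
import Summits.NavierStokesRegularity.NavierStokesRegularity.Theorems.RellichScarApexLocalisationParentChild

/-!
# Confinement implies the apex bound, uniformly in the class
# (line activity-genealogy-fission, crux ApexLocalisation, stub `stub_confinementImpliesApex`)

The class of the line: suitable weak solutions `(u, p)` of Navier–Stokes on the backward slab
`𝕊 = (-∞, 0) × ℝ³` with weak spatial gradient `G`, Albritton–Barker quantity `𝐈(u,p,G) ≤ I`,
the Type-I rate `‖u(t,x)‖ ≤ C/√(−t)` (`HasTypeITimeDecay C u`), continuous on the open slab.
A profile is `η`-QUIET OUTSIDE THE PARABOLOID of aperture `R` when its Type-I activity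
`√(−t) ‖u(t,x)‖` is `≤ η` at every point with `t < 0`, `R √(−t) ≤ ‖x‖`.

`stub_confinementImpliesApex` (S1b): granted CLASS BLOW-UP PERSISTENCE (hypothesis `hE`, the
landed `stub_classBlowupPersistence`) and SMALL-RATE REGULARITY (hypothesis `hS1a`, the landed
`stub_smallRateRegularity`), for all `C` and `I < ⊤` there is `η > 0` such that for every
aperture `R > 0` some constant `C'` works uniformly: every continuous class profile `(C, I)` which
is `η`-quiet outside the paraboloid of aperture `R` obeys the apex bound `HasTypeIDecay C' u`.

Proof (contradiction): `η` is the threshold of `hS1a` at `𝐈 ≤ 4I`. Violators `u_k` of the apex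
bound at the levels `k + (R+1)C` carry points `(t_k, x_k)` which the rate puts outside the
paraboloid, so quietness gives `a_k = ‖x_k‖ ‖u_k(t_k,x_k)‖ → ∞` and `s_k = t_k/‖x_k‖² → 0⁻`.
`hE` at scales `‖x_k‖`, centres `x_k`, times `s_k` gives an ORIGIN-SINGULAR continuous class
limit `v` (`C, 4I`) of the images `w_k(s,y) = ‖x_k‖ u_k(‖x_k‖² s, x_k + ‖x_k‖ y)`, which are
`η`-quiet where `R√(−s) ≤ ‖e_k + y‖`, `e_k = x_k/‖x_k‖` (`sqrt_mul_norm_image_le_of_quiet`); along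
`e_k → e₀` the quietness passes to `v` a.e. on the open set `{R√(−s) < ‖e₀ + y‖} ⊇ Q(0, r₀)`,
`r₀ = min (1/2) (1/(2R))` (`ae_slab_le_of_eventually_le_of_tendsto_eLpNorm`), then everywhere
there by continuity (`sqrt_mul_norm_le_of_ae_of_continuousOn`). The zoom `r₀ v(r₀² s, r₀ y)` is
a class profile (`C, 4I`) (`image_classData`), singular at the origin
(`isBackwardSingularPoint_image_preimageOrigin`), with the small rate `η/√(−s)` on `Q(0,1)` —
impossible by `hS1a`.

## References

* D. Albritton, T. Barker, *On local Type I singularities of the Navier–Stokes equations and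
  Liouville theorems*, J. Math. Fluid Mech. 21 (2019) = arXiv:1811.00502, Lemma 2.2, Prop. 2.3,
  §3. [AlbrittonBarker2019]
-/

set_option linter.dupNamespace false

namespace Summit.NavierStokesRegularity.NavierStokesRegularity.Theorems.RellichScarApexLocalisation

open MeasureTheory Set Function Metric Filter Topology TopologicalSpace
open scoped ENNReal NNReal
open Literature.Analysis Literature.Analysis.FluidPDE

/-! ### Tool 1: quietness outside the paraboloid is inherited by Navier–Stokes images -/

/-- **Quietness transport.** If `u` is `η`-quiet outside the paraboloid of aperture `R`
(`√(−t) ‖u(t,x)‖ ≤ η` whenever `t < 0`, `R √(−t) ≤ ‖x‖`), then its Navier–Stokes image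
`w(s,y) = λ u(λ² s, x₀ + λ y)` (`λ > 0`) satisfies `√(−s) ‖w(s,y)‖ ≤ η` whenever `s < 0` and
`R √(−s) ≤ ‖λ⁻¹ x₀ + y‖` (the same paraboloid, seen from the new origin `-λ⁻¹ x₀`). -/
theorem sqrt_mul_norm_image_le_of_quiet
    {u : ℝ → (EuclideanSpace ℝ (Fin 3)) → (EuclideanSpace ℝ (Fin 3))} {η R lam : ℝ}
    {x₀ : EuclideanSpace ℝ (Fin 3)} (hlam : 0 < lam)
    (hq : ∀ t : ℝ, t < 0 → ∀ x : (EuclideanSpace ℝ (Fin 3)), R * Real.sqrt (-t) ≤ ‖x‖ →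
      Real.sqrt (-t) * ‖u t x‖ ≤ η)
    {s : ℝ} (hs : s < 0) {y : EuclideanSpace ℝ (Fin 3)}
    (hy : R * Real.sqrt (-s) ≤ ‖lam⁻¹ • x₀ + y‖) :
    Real.sqrt (-s) * ‖(lam • stPull (lam ^ 2) lam 0 x₀ u) s y‖ ≤ η := by
  have ht : lam ^ 2 * s < 0 := mul_neg_of_pos_of_neg (by positivity) hs
  have hsqrt : Real.sqrt (-(lam ^ 2 * s)) = lam * Real.sqrt (-s) := by
    rw [neg_mul_eq_mul_neg, Real.sqrt_mul (by positivity) (-s), Real.sqrt_sq hlam.le]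
  have hx : x₀ + lam • y = lam • (lam⁻¹ • x₀ + y) := by
    rw [smul_add, smul_smul, mul_inv_cancel₀ hlam.ne', one_smul]
  have hnorm : R * Real.sqrt (-(lam ^ 2 * s)) ≤ ‖x₀ + lam • y‖ := by
    rw [hsqrt, hx, norm_smul, Real.norm_of_nonneg hlam.le]
    calc R * (lam * Real.sqrt (-s)) = lam * (R * Real.sqrt (-s)) := by ring
      _ ≤ lam * ‖lam⁻¹ • x₀ + y‖ := mul_le_mul_of_nonneg_left hy hlam.le
  have key := hq (lam ^ 2 * s) ht (x₀ + lam • y) hnorm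
  rw [hsqrt] at key
  rw [smul_stPull_apply, zero_add, norm_smul, Real.norm_of_nonneg hlam.le]
  calc Real.sqrt (-s) * (lam * ‖u (lam ^ 2 * s) (x₀ + lam • y)‖)
      = lam * Real.sqrt (-s) * ‖u (lam ^ 2 * s) (x₀ + lam • y)‖ := by ring
    _ ≤ η := key

/-! ### Tool 2: eventual pointwise bounds pass a.e. to `L³_loc` limits on the slab -/

/-- **Eventual weighted bounds pass a.e. to `L³_loc` limits.** If measurable fields `W j` converge
to a measurable `v` in `L³(Q(0, n+1))` for every `n`, and at each point `z` of the open slab with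
`P z` the weighted bound `g z * ‖W j z‖ ≤ B` holds for all large `j`, then `g z * ‖v z‖ ≤ B` for
a.e. `z` in the slab with `P z` (a.e.-convergent subsequences ball by ball; the balls `Q(0, n+1)`
exhaust the slab). -/
theorem ae_slab_le_of_eventually_le_of_tendsto_eLpNorm
    {W : ℕ → ℝ → (EuclideanSpace ℝ (Fin 3)) → (EuclideanSpace ℝ (Fin 3))}
    {v : ℝ → (EuclideanSpace ℝ (Fin 3)) → (EuclideanSpace ℝ (Fin 3))}
    {P : ℝ × (EuclideanSpace ℝ (Fin 3)) → Prop} {g : ℝ × (EuclideanSpace ℝ (Fin 3)) → ℝ} {B : ℝ}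
    (hWm : ∀ j, AEStronglyMeasurable (uncurry (W j))
      (volume.restrict (Iio (0 : ℝ) ×ˢ (univ : Set (EuclideanSpace ℝ (Fin 3))))))
    (hvm : AEStronglyMeasurable (uncurry v)
      (volume.restrict (Iio (0 : ℝ) ×ˢ (univ : Set (EuclideanSpace ℝ (Fin 3))))))
    (hWB : ∀ z : ℝ × (EuclideanSpace ℝ (Fin 3)), z.1 < 0 → P z →
      ∀ᶠ j in atTop, g z * ‖W j z.1 z.2‖ ≤ B)
    (hL3 : ∀ n : ℕ, Tendsto (fun j => eLpNorm (uncurry (W j) - uncurry v) 3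
      (volume.restrict (parabolicCylinder ((n : ℝ) + 1) (0 : ℝ × (EuclideanSpace ℝ (Fin 3))))))
      atTop (𝓝 0)) :
    ∀ᵐ z ∂(volume.restrict (Iio (0 : ℝ) ×ˢ (univ : Set (EuclideanSpace ℝ (Fin 3))))),
      P z → g z * ‖v z.1 z.2‖ ≤ B := by
  refine ae_restrict_of_ae_restrict_of_subset lowerHalf_subset_iUnion_parabolicCylinder ?_
  rw [ae_restrict_iUnion_iff]
  intro n
  set Q₀ : Set (ℝ × (EuclideanSpace ℝ (Fin 3))) :=
    parabolicCylinder ((n : ℝ) + 1) (0 : ℝ × (EuclideanSpace ℝ (Fin 3)))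
  have hQ₀s : Q₀ ⊆ Iio (0 : ℝ) ×ˢ (univ : Set (EuclideanSpace ℝ (Fin 3))) :=
    parabolicCylinder_origin_subset_slab _
  have hWm' : ∀ j, AEStronglyMeasurable (uncurry (W j)) (volume.restrict Q₀) := fun j =>
    (hWm j).mono_measure (Measure.restrict_mono hQ₀s le_rfl)
  have hvm' : AEStronglyMeasurable (uncurry v) (volume.restrict Q₀) :=
    hvm.mono_measure (Measure.restrict_mono hQ₀s le_rfl)
  have hTIM : TendstoInMeasure (volume.restrict Q₀) (fun j => uncurry (W j)) atTop (uncurry v) :=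
    tendstoInMeasure_of_tendsto_eLpNorm (by norm_num) hWm' hvm' (hL3 n)
  obtain ⟨ns, hns, hae⟩ := hTIM.exists_seq_tendsto_ae
  filter_upwards [hae, ae_restrict_mem (isOpen_parabolicCylinder _ _).measurableSet] with z hz hzQ
  intro hP
  have hz0 : z.1 < 0 := (hQ₀s hzQ).1
  have hev : ∀ᶠ i in atTop, g z * ‖W (ns i) z.1 z.2‖ ≤ B :=
    hns.tendsto_atTop.eventually (hWB z hz0 hP)
  exact le_of_tendsto (hz.norm.const_mul (g z)) hev

/-! ### Tool 3: a.e. quietness is quietness, for continuous fields -/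

/-- **A.e. quietness is quietness, for continuous fields.** If `v` is continuous on the open slab
and `√(−t) ‖v(t,y)‖ ≤ η` for a.e. `(t,y)` in the slab with `R √(−t) < ‖e₀ + y‖`, then the bound
holds at EVERY such point: the failure set is open, so it is empty or has positive volume. -/
theorem sqrt_mul_norm_le_of_ae_of_continuousOn
    {v : ℝ → (EuclideanSpace ℝ (Fin 3)) → (EuclideanSpace ℝ (Fin 3))} {R η : ℝ}
    {e₀ : EuclideanSpace ℝ (Fin 3)}
    (hvcont : ContinuousOn (uncurry v) (Iio (0 : ℝ) ×ˢ univ))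
    (hae : ∀ᵐ z ∂(volume.restrict (Iio (0 : ℝ) ×ˢ (univ : Set (EuclideanSpace ℝ (Fin 3))))),
      R * Real.sqrt (-z.1) < ‖e₀ + z.2‖ → Real.sqrt (-z.1) * ‖v z.1 z.2‖ ≤ η) :
    ∀ s : ℝ, s < 0 → ∀ y : EuclideanSpace ℝ (Fin 3), R * Real.sqrt (-s) < ‖e₀ + y‖ →
      Real.sqrt (-s) * ‖v s y‖ ≤ η := by
  intro s hs y hy
  by_contra hlt
  push Not at hlt
  -- the open set `O` of points of the slab seen outside the paraboloid from `-e₀`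
  set O : Set (ℝ × (EuclideanSpace ℝ (Fin 3))) :=
    {z | z.1 < 0 ∧ R * Real.sqrt (-z.1) < ‖e₀ + z.2‖}
  have hOopen : IsOpen O :=
    (isOpen_lt continuous_fst continuous_const).and
      (isOpen_lt (continuous_const.mul continuous_fst.neg.sqrt)
        (continuous_const.add continuous_snd).norm)
  have hOs : O ⊆ Iio (0 : ℝ) ×ˢ univ := fun z hz => ⟨hz.1, mem_univ _⟩
  -- the failure set is open and contains `(s, y)`, so it has positive volume ...
  have hg : ContinuousOn
      (fun z : ℝ × (EuclideanSpace ℝ (Fin 3)) => Real.sqrt (-z.1) * ‖uncurry v z‖) O :=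
    continuous_fst.neg.sqrt.continuousOn.mul (hvcont.mono hOs).norm
  have hVopen : IsOpen (O ∩ (fun z : ℝ × (EuclideanSpace ℝ (Fin 3)) =>
      Real.sqrt (-z.1) * ‖uncurry v z‖) ⁻¹' Ioi η) :=
    hg.isOpen_inter_preimage hOopen isOpen_Ioi
  have hmem : ((s, y) : ℝ × (EuclideanSpace ℝ (Fin 3))) ∈
      O ∩ (fun z : ℝ × (EuclideanSpace ℝ (Fin 3)) =>
        Real.sqrt (-z.1) * ‖uncurry v z‖) ⁻¹' Ioi η :=
    ⟨⟨hs, hy⟩, hlt⟩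
  have hpos := hVopen.measure_pos volume ⟨_, hmem⟩
  -- ... yet it is null
  have hnull : volume.restrict (Iio (0 : ℝ) ×ˢ (univ : Set (EuclideanSpace ℝ (Fin 3))))
      (O ∩ (fun z : ℝ × (EuclideanSpace ℝ (Fin 3)) =>
        Real.sqrt (-z.1) * ‖uncurry v z‖) ⁻¹' Ioi η) = 0 := by
    refine measure_mono_null (fun z hz => ?_) (ae_iff.1 hae)
    have h2 : η < Real.sqrt (-z.1) * ‖uncurry v z‖ := hz.2
    exact fun h => (not_le.2 h2) (h hz.1.2)
  rw [Measure.restrict_apply hVopen.measurableSet,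
    inter_eq_left.2 (inter_subset_left.trans hOs)] at hnull
  exact hpos.ne' hnull

/-! ### The stub -/

/-- **S1b, CONFINEMENT ⇒ APEX, uniformly in the class** (the card's first lemma in the continuous
class), granted class blow-up persistence (E) and small-rate regularity (S1a): for all `C` and
`I < ⊤` there is `η > 0` such that for every aperture `R > 0` some `C' = C'(C, I, R)` works
uniformly — a continuous class profile `(C, I)` that is `η`-quiet outside the paraboloid
`‖x‖ ≥ R√(−t)` satisfies `‖u(t,x)‖ ≤ C'/(‖x‖ + √(−t))` everywhere on the open slab.
(Contradiction: violators blow up at points outside the paraboloid with `t_k/‖x_k‖² → 0`; E at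
scales `‖x_k‖`, centres `x_k` gives an origin-singular continuous limit which is `η`-quiet on a
small cylinder `Q(0, r₀)` — absurd by S1a after the zoom `1/r₀`, at `𝐈 ≤ 4I`.) -/
theorem stub_confinementImpliesApex
    (hE : ∀ (C : ℝ) (I : ℝ≥0∞)
      (uk : ℕ → ℝ → (EuclideanSpace ℝ (Fin 3)) → (EuclideanSpace ℝ (Fin 3)))
      (pk : ℕ → ℝ → (EuclideanSpace ℝ (Fin 3)) → ℝ)
      (Gk : ℕ → ℝ → (EuclideanSpace ℝ (Fin 3)) →
        (EuclideanSpace ℝ (Fin 3)) →L[ℝ] (EuclideanSpace ℝ (Fin 3)))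
      (lk : ℕ → ℝ) (xk : ℕ → (EuclideanSpace ℝ (Fin 3))) (tk : ℕ → ℝ),
      I < ⊤ →
      (∀ k, IsSuitableWeakSolutionOn (slab (EuclideanSpace ℝ (Fin 3)) (Iio 0) isOpen_Iio) 1 0
        (uk k) (pk k)) →
      (∀ k, HasWeakSpatialGradientOn (slab (EuclideanSpace ℝ (Fin 3)) (Iio 0) isOpen_Iio)
        (uk k) (Gk k)) →
      (∀ k, typeIBound (Iio (0 : ℝ) ×ˢ univ) (uk k) (pk k) (Gk k) ≤ I) →
      (∀ k, HasTypeITimeDecay C (uk k)) →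
      (∀ k, ContinuousOn (uncurry (uk k)) (Iio (0 : ℝ) ×ˢ univ)) →
      (∀ k, 0 < lk k) → (∀ k, tk k < 0) → Tendsto tk atTop (𝓝 0) →
      Tendsto (fun k => lk k * ‖uk k (lk k ^ 2 * tk k) (xk k)‖) atTop atTop →
      ∃ (σ : ℕ → ℕ) (v : ℝ → (EuclideanSpace ℝ (Fin 3)) → (EuclideanSpace ℝ (Fin 3)))
        (q : ℝ → (EuclideanSpace ℝ (Fin 3)) → ℝ)
        (H : ℝ → (EuclideanSpace ℝ (Fin 3)) →
          (EuclideanSpace ℝ (Fin 3)) →L[ℝ] (EuclideanSpace ℝ (Fin 3))),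
        StrictMono σ ∧
        IsSuitableWeakSolutionOn (slab (EuclideanSpace ℝ (Fin 3)) (Iio 0) isOpen_Iio) 1 0 v q ∧
        HasWeakSpatialGradientOn (slab (EuclideanSpace ℝ (Fin 3)) (Iio 0) isOpen_Iio) v H ∧
        typeIBound (Iio (0 : ℝ) ×ˢ univ) v q H ≤ 4 * I ∧
        HasTypeITimeDecay C v ∧
        ContinuousOn (uncurry v) (Iio (0 : ℝ) ×ˢ univ) ∧
        IsBackwardSingularPoint v 0 ∧
        ∀ R : ℝ, 0 < R → Tendsto (fun j => eLpNorm
          (uncurry (lk (σ j) • stPull (lk (σ j) ^ 2) (lk (σ j)) 0 (xk (σ j)) (uk (σ j))) -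
            uncurry v) 3
          (volume.restrict (parabolicCylinder R (0 : ℝ × (EuclideanSpace ℝ (Fin 3))))))
            atTop (𝓝 0))
    (hS1a : ∀ I : ℝ≥0∞, I < ⊤ → ∃ η : ℝ, 0 < η ∧
      ∀ (u : ℝ → (EuclideanSpace ℝ (Fin 3)) → (EuclideanSpace ℝ (Fin 3)))
        (p : ℝ → (EuclideanSpace ℝ (Fin 3)) → ℝ)
        (G : ℝ → (EuclideanSpace ℝ (Fin 3)) →
          (EuclideanSpace ℝ (Fin 3)) →L[ℝ] (EuclideanSpace ℝ (Fin 3))),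
        IsSuitableWeakSolutionOn (slab (EuclideanSpace ℝ (Fin 3)) (Iio 0) isOpen_Iio) 1 0 u p →
        HasWeakSpatialGradientOn (slab (EuclideanSpace ℝ (Fin 3)) (Iio 0) isOpen_Iio) u G →
        typeIBound (Iio (0 : ℝ) ×ˢ univ) u p G ≤ I →
        (∀ᵐ z ∂(volume.restrict (parabolicCylinder 1 (0 : ℝ × (EuclideanSpace ℝ (Fin 3))))),
          ‖u z.1 z.2‖ ≤ η / Real.sqrt (-z.1)) →
        ¬ IsBackwardSingularPoint u 0) :
    ∀ (C : ℝ) (I : ℝ≥0∞), I < ⊤ → ∃ η : ℝ, 0 < η ∧ ∀ R : ℝ, 0 < R → ∃ C' : ℝ,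
      ∀ (u : ℝ → (EuclideanSpace ℝ (Fin 3)) → (EuclideanSpace ℝ (Fin 3)))
        (p : ℝ → (EuclideanSpace ℝ (Fin 3)) → ℝ)
        (G : ℝ → (EuclideanSpace ℝ (Fin 3)) →
          (EuclideanSpace ℝ (Fin 3)) →L[ℝ] (EuclideanSpace ℝ (Fin 3))),
        IsSuitableWeakSolutionOn (slab (EuclideanSpace ℝ (Fin 3)) (Iio 0) isOpen_Iio) 1 0 u p →
        HasWeakSpatialGradientOn (slab (EuclideanSpace ℝ (Fin 3)) (Iio 0) isOpen_Iio) u G →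
        typeIBound (Iio (0 : ℝ) ×ˢ univ) u p G ≤ I →
        HasTypeITimeDecay C u →
        ContinuousOn (uncurry u) (Iio (0 : ℝ) ×ˢ univ) →
        (∀ t : ℝ, t < 0 → ∀ x : (EuclideanSpace ℝ (Fin 3)), R * Real.sqrt (-t) ≤ ‖x‖ →
          Real.sqrt (-t) * ‖u t x‖ ≤ η) →
        HasTypeIDecay C' u := by
  intro C I hI
  have h4I : 4 * I < ⊤ := ENNReal.mul_lt_top (by simp) hI
  obtain ⟨η, hη, hreg⟩ := hS1a (4 * I) h4I
  refine ⟨η, hη, fun R hR => ?_⟩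
  by_contra hcon
  push Not at hcon
  -- ## Step 1: violators of the apex bound at the levels `k + (R + 1) C`, `k : ℕ`
  choose u p G hsw hwg hIle hC hcont hquiet hnot using
    fun k : ℕ => hcon ((k : ℝ) + (R + 1) * C)
  have hbad : ∀ k : ℕ, ∃ t : ℝ, t < 0 ∧ ∃ x : EuclideanSpace ℝ (Fin 3),
      ((k : ℝ) + (R + 1) * C) / (‖x‖ + Real.sqrt (-t)) < ‖u k t x‖ := fun k => by
    have h := hnot k
    unfold HasTypeIDecay at h
    push Not at h
    exact h
  choose t ht x hlt using hbad
  have hρ : ∀ k, 0 < Real.sqrt (-t k) := fun k => Real.sqrt_pos.2 (neg_pos.2 (ht k))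
  have hlt' : ∀ k : ℕ, (k : ℝ) + (R + 1) * C <
      (‖x k‖ + Real.sqrt (-t k)) * ‖u k (t k) (x k)‖ := fun k => by
    have h := hlt k
    rw [div_lt_iff₀ (add_pos_of_nonneg_of_pos (norm_nonneg _) (hρ k))] at h
    linarith
  -- the rate `√(-t) ‖u‖ ≤ C` puts the violating points outside the paraboloid
  have hrate : ∀ k, Real.sqrt (-t k) * ‖u k (t k) (x k)‖ ≤ C := fun k => by
    rw [mul_comm]
    exact (le_div_iff₀ (hρ k)).1 (hC k (t k) (ht k) (x k))
  have hout : ∀ k, R * Real.sqrt (-t k) ≤ ‖x k‖ := fun k => by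
    by_contra h
    push Not at h
    have h3 : (‖x k‖ + Real.sqrt (-t k)) * ‖u k (t k) (x k)‖ ≤
        (R + 1) * (Real.sqrt (-t k) * ‖u k (t k) (x k)‖) :=
      calc (‖x k‖ + Real.sqrt (-t k)) * ‖u k (t k) (x k)‖
          ≤ (R * Real.sqrt (-t k) + Real.sqrt (-t k)) * ‖u k (t k) (x k)‖ :=
            mul_le_mul_of_nonneg_right (add_le_add h.le le_rfl) (norm_nonneg _)
        _ = (R + 1) * (Real.sqrt (-t k) * ‖u k (t k) (x k)‖) := by ring
    have h4 : (R + 1) * (Real.sqrt (-t k) * ‖u k (t k) (x k)‖) ≤ (R + 1) * C :=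
      mul_le_mul_of_nonneg_left (hrate k) (by linarith)
    have h5 : (0 : ℝ) ≤ k := k.cast_nonneg
    linarith [hlt' k]
  have hxpos : ∀ k, 0 < ‖x k‖ := fun k => lt_of_lt_of_le (mul_pos hR (hρ k)) (hout k)
  -- quietness at the violating points, so `a_k = ‖x_k‖ ‖u_k(t_k, x_k)‖ → ∞`
  have hq0 : ∀ k, Real.sqrt (-t k) * ‖u k (t k) (x k)‖ ≤ η := fun k =>
    hquiet k (t k) (ht k) (x k) (hout k)
  have ha : ∀ k : ℕ, (k : ℝ) + ((R + 1) * C - η) ≤ ‖x k‖ * ‖u k (t k) (x k)‖ := fun k => by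
    have e : (‖x k‖ + Real.sqrt (-t k)) * ‖u k (t k) (x k)‖ =
        ‖x k‖ * ‖u k (t k) (x k)‖ + Real.sqrt (-t k) * ‖u k (t k) (x k)‖ := by ring
    linarith [hlt' k, hq0 k]
  have hatop : Tendsto (fun k => ‖x k‖ * ‖u k (t k) (x k)‖) atTop atTop :=
    tendsto_atTop_mono ha (tendsto_atTop_add_const_right _ _ tendsto_natCast_atTop_atTop)
  -- ## Step 2: scales `‖x_k‖` and times `s_k = t_k / ‖x_k‖² → 0⁻`
  set s : ℕ → ℝ := fun k => t k / ‖x k‖ ^ 2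
  have hs_neg : ∀ k, s k < 0 := fun k => div_neg_of_neg_of_pos (ht k) (pow_pos (hxpos k) 2)
  have hts : ∀ k, ‖x k‖ ^ 2 * s k = t k := fun k =>
    mul_div_cancel₀ (t k) (pow_pos (hxpos k) 2).ne'
  have hs0 : Tendsto s atTop (𝓝 0) := by
    have hsq : ∀ k, -s k * (‖x k‖ * ‖u k (t k) (x k)‖) ^ 2 ≤ η ^ 2 := fun k => by
      have h1 : -s k * ‖x k‖ ^ 2 = Real.sqrt (-t k) ^ 2 := by
        rw [Real.sq_sqrt (neg_pos.2 (ht k)).le, ← hts k]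
        ring
      have h2 : (Real.sqrt (-t k) * ‖u k (t k) (x k)‖) ^ 2 ≤ η ^ 2 :=
        pow_le_pow_left₀ (mul_nonneg (Real.sqrt_nonneg _) (norm_nonneg _)) (hq0 k) 2
      calc -s k * (‖x k‖ * ‖u k (t k) (x k)‖) ^ 2
          = -s k * ‖x k‖ ^ 2 * ‖u k (t k) (x k)‖ ^ 2 := by ring
        _ = (Real.sqrt (-t k) * ‖u k (t k) (x k)‖) ^ 2 := by rw [h1]; ring
        _ ≤ η ^ 2 := h2
    have hb : Tendsto (fun k => η ^ 2 / (‖x k‖ * ‖u k (t k) (x k)‖) ^ 2) atTop (𝓝 0) :=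
      tendsto_const_nhds.div_atTop ((tendsto_pow_atTop two_ne_zero).comp hatop)
    have hneg : Tendsto (fun k => -s k) atTop (𝓝 0) := by
      refine squeeze_zero' (Eventually.of_forall fun k => (neg_pos.2 (hs_neg k)).le) ?_ hb
      filter_upwards [hatop.eventually_ge_atTop 1] with k hk
      rw [le_div_iff₀ (pow_pos (lt_of_lt_of_le one_pos hk) 2)]
      exact hsq k
    simpa using hneg.neg
  have hblow : Tendsto (fun k => ‖x k‖ * ‖u k (‖x k‖ ^ 2 * s k) (x k)‖) atTop atTop :=
    hatop.congr fun k => by rw [hts k]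
  -- ## Step 3: the engine E at scales `‖x_k‖`, centres `x_k`, times `s_k`
  obtain ⟨σ, v, q, H, -, hv, hvg, hvI, hvC, hvcont, hvsing, hconv⟩ :=
    hE C I u p G (fun k => ‖x k‖) x s hI hsw hwg hIle hC hcont hxpos hs_neg hs0 hblow
  have hcd := fun k => image_classData (hsw k) (hwg k) (hIle k) (hC k) (hcont k) (hxpos k) (x k)
  -- ## Step 4: a convergent subsequence of the unit vectors `e_k = x_k / ‖x_k‖`
  have hemem : ∀ j, ‖x (σ j)‖⁻¹ • x (σ j) ∈ Metric.sphere (0 : EuclideanSpace ℝ (Fin 3)) 1 :=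
    fun j => by
    rw [mem_sphere_zero_iff_norm, norm_smul, Real.norm_of_nonneg (inv_nonneg.2 (norm_nonneg _)),
      inv_mul_cancel₀ (hxpos _).ne']
  obtain ⟨e₀, he₀, φ, hφ, hφe⟩ :=
    (isCompact_sphere (0 : EuclideanSpace ℝ (Fin 3)) 1).tendsto_subseq hemem
  have he₀1 : ‖e₀‖ = 1 := mem_sphere_zero_iff_norm.1 he₀
  -- ## Step 5: the limit is `η`-quiet where `R √(-s) < ‖e₀ + y‖`: a.e., then everywhere
  have hae : ∀ᵐ z ∂(volume.restrict (Iio (0 : ℝ) ×ˢ (univ : Set (EuclideanSpace ℝ (Fin 3))))),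
      R * Real.sqrt (-z.1) < ‖e₀ + z.2‖ → Real.sqrt (-z.1) * ‖v z.1 z.2‖ ≤ η := by
    refine ae_slab_le_of_eventually_le_of_tendsto_eLpNorm
      (W := fun j => ‖x (σ (φ j))‖ • stPull (‖x (σ (φ j))‖ ^ 2) ‖x (σ (φ j))‖ 0 (x (σ (φ j)))
        (u (σ (φ j))))
      (P := fun z => R * Real.sqrt (-z.1) < ‖e₀ + z.2‖) (g := fun z => Real.sqrt (-z.1))
      (fun j => (hcd (σ (φ j))).2.1.locallyIntegrableOn.aestronglyMeasurable)
      hvg.locallyIntegrableOn.aestronglyMeasurable (fun z hz0 hz => ?_)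
      (fun n => (hconv ((n : ℝ) + 1) (by positivity)).comp hφ.tendsto_atTop)
    have hlim : Tendsto (fun j => ‖‖x (σ (φ j))‖⁻¹ • x (σ (φ j)) + z.2‖) atTop
        (𝓝 ‖e₀ + z.2‖) :=
      (hφe.add_const z.2).norm
    filter_upwards [hlim.eventually_const_lt hz] with j hj
    exact sqrt_mul_norm_image_le_of_quiet (hxpos _) (hquiet _) hz0 hj.le
  have hU : ∀ s' : ℝ, s' < 0 → ∀ y : EuclideanSpace ℝ (Fin 3),
      R * Real.sqrt (-s') < ‖e₀ + y‖ → Real.sqrt (-s') * ‖v s' y‖ ≤ η :=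
    sqrt_mul_norm_le_of_ae_of_continuousOn hvcont hae
  -- ## Step 6: the zoom by `r₀ = min (1/2) (1/(2R))`: class data, singular origin, small rate
  set r₀ : ℝ := min (1 / 2) (1 / (2 * R))
  have hr₀ : 0 < r₀ := lt_min (by norm_num) (by positivity)
  have hr₀h : r₀ ≤ 1 / 2 := min_le_left _ _
  have hr₀R : R * r₀ ≤ 1 / 2 := by
    have h : r₀ ≤ 1 / (2 * R) := min_le_right _ _
    rw [le_div_iff₀ (by positivity)] at h
    linarith
  obtain ⟨hsw', hwg', hI', -, -⟩ := image_classData hv hvg hvI hvC hvcont hr₀ 0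
  have hsing' : IsBackwardSingularPoint (r₀ • stPull (r₀ ^ 2) r₀ 0 0 v) 0 := by
    have h := isBackwardSingularPoint_image_preimageOrigin hvsing hr₀
      (0 : EuclideanSpace ℝ (Fin 3))
    rwa [smul_zero, neg_zero] at h
  have hsmall : ∀ᵐ z ∂(volume.restrict (parabolicCylinder 1 (0 : ℝ × (EuclideanSpace ℝ (Fin 3))))),
      ‖(r₀ • stPull (r₀ ^ 2) r₀ 0 0 v) z.1 z.2‖ ≤ η / Real.sqrt (-z.1) := by
    refine ae_restrict_of_forall_mem (isOpen_parabolicCylinder _ _).measurableSet fun z hz => ?_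
    rw [mem_parabolicCylinder] at hz
    simp only [Prod.fst_zero, Prod.snd_zero, zero_sub, one_pow, dist_zero_right] at hz
    obtain ⟨⟨hz1, hz2⟩, hz3⟩ := hz
    have hzs : 0 < Real.sqrt (-z.1) := Real.sqrt_pos.2 (neg_pos.2 hz2)
    have hs1 : Real.sqrt (-z.1) < 1 := by
      rw [Real.sqrt_lt' one_pos, one_pow]
      linarith
    have hsq : Real.sqrt (-(r₀ ^ 2 * z.1)) = r₀ * Real.sqrt (-z.1) := by
      rw [neg_mul_eq_mul_neg, Real.sqrt_mul (by positivity) (-z.1), Real.sqrt_sq hr₀.le]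
    -- the point `(r₀² t, r₀ y)` is seen outside the paraboloid from `-e₀`
    have hin : R * Real.sqrt (-(r₀ ^ 2 * z.1)) < ‖e₀ + r₀ • z.2‖ := by
      have h1 : 1 - r₀ < ‖e₀ + r₀ • z.2‖ := by
        have h := norm_sub_norm_le e₀ (-(r₀ • z.2))
        rw [norm_neg, sub_neg_eq_add, norm_smul, Real.norm_of_nonneg hr₀.le, he₀1] at h
        have h' : r₀ * ‖z.2‖ < r₀ := mul_lt_of_lt_one_right hr₀ hz3
        linarith
      have h2 : R * (r₀ * Real.sqrt (-z.1)) < R * r₀ := by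
        rw [← mul_assoc]
        exact mul_lt_of_lt_one_right (mul_pos hR hr₀) hs1
      rw [hsq]
      linarith
    have key := hU (r₀ ^ 2 * z.1) (mul_neg_of_pos_of_neg (by positivity) hz2) (r₀ • z.2) hin
    rw [hsq] at key
    rw [smul_stPull_apply, zero_add, zero_add, norm_smul, Real.norm_of_nonneg hr₀.le,
      le_div_iff₀ hzs]
    calc r₀ * ‖v (r₀ ^ 2 * z.1) (r₀ • z.2)‖ * Real.sqrt (-z.1)
        = r₀ * Real.sqrt (-z.1) * ‖v (r₀ ^ 2 * z.1) (r₀ • z.2)‖ := by ring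
      _ ≤ η := key
  -- ## Step 7: small-rate regularity kills the singular origin
  exact hreg _ _ _ hsw' hwg' hI' hsmall hsing'

end Summit.NavierStokesRegularity.NavierStokesRegularity.Theorems.RellichScarApexLocalisation
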